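import Literature.AlgebraicGeometry.Motives.KugaSatakeOfK3TypeForm
import Literature.AlgebraicGeometry.Motives.KugaSatakeFunctoriality
import Literature.AlgebraicGeometry.Motives.HodgeStructureAbelianTypeTensorPower
import HarnessLib

/-!
# Functoriality of the Kuga–Satake structure of an admissible form under Hodge similarities

Layer `Literature/AlgebraicGeometry/Motives`, lane `lit-hodgefound` (Track 2 foundations library),
Layer A1, row **A1-39** of `run/shared/lean/pub/lit-hodgefound/SKELETON.md` (seat
`lit-hodgefound-skel-1`, generation 12): the transport tool for FILE 3b of the row (carrying the
Kuga–Satake structure of a complex `2`-torus, built in `Geometry/Kaehler/ComplexTorusKugaSatake` on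
`Cl⁺(H²(X, ℚ), ⟨ , ⟩_e)`, to the Plücker model `Cl⁺(⋀²V, Q_b)` of
`Motives/KugaSatakeOfExteriorSquare`).

The tree's `Motives/KugaSatakeFunctoriality` (Varesco, *Hodge similarities, algebraic classes, and
Kuga–Satake varieties*, Lemmas 3.2–3.3) proves, for POLARIZED weight-two structures, that a Hodge
similarity `f : (V, H, Q) → (V', H', Q')` of unit multiplier `c` induces the morphism
`ψ_Cl : C⁺(Q) → C⁺(Q')` (`KugaSatake.evenMapOfSimilar`) of Kuga–Satake Hodge structures
(`kugaSatakeMap`). This file proves the same statement for the Kuga–Satake structure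
`kugaSatakeOfForm H q h` of an ADMISSIBLE quadratic form (`Motives/KugaSatakeOfK3TypeForm`,
Huybrechts Rem. 2.3: any `q` with `q(σ) = 0`, `q(σ, σ̄) ≠ 0` on `V^{2,0}`, `h^{2,0} = 1` — e.g. the
intersection form of a complex torus, which is not a polarization), following Varesco's proof
verbatim:

> Lemma 3.3. "The map `ψ_{Cl,ℝ} : Cl⁺(V)_ℝ → Cl⁺(V')_ℝ` is compatible with the natural complex
> structures on `Cl⁺(V)_ℝ` and `Cl⁺(V')_ℝ`." (Proof: `ψ` maps the basis `e₁, e₂` of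
> `(V^{2,0} ⊕ V^{0,2})_ℝ` to `√λ e'₁, √λ e'₂`, and `ψ(Jx) = ψ(e₁e₂x) = λ e'₁e'₂ ψ(x) = J'ψ(x)`.)

Here, as in the tree's polarized file: `f_ℂ` maps a generator `ω` of `V^{2,0}` to a generator of
`V'^{2,0}`, `C^{1,0} = {x : (ω̄ω)·x = 0}` intrinsically in `C⁺_ℂ`
(`IsKugaSatakeAdmissible.mem_kugaSatakeFormF1_iff_mulVecC_mul_eq_zero`), and
`ψ_ℂ((ω̄ω)x) = c⁻¹(f ω̄ · f ω)ψ_ℂ(x)` (`KugaSatake.baseChange_evenMapOfSimilar_mulVecC`).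

## Main results (all proved, no named facts)

* `polarBilin_baseChange_apply_apply_of_similar`: `q'_ℂ(f x, f y) = c · q_ℂ(x, y)` for a similarity.
* `IsKugaSatakeAdmissible.of_similar`: admissibility is transported along an injective Hodge
  similarity onto a structure with `h'^{2,0} = 1`.
* `kugaSatakeOfFormMap h h' f hfi c hf : Hom (kugaSatakeOfForm H q h) (kugaSatakeOfForm H' q' h')`
  — Varesco Lemma 3.3 for admissible forms.
* `comap_kugaSatakeOfForm_F_eq`: for a bijective Hodge similarity `e` (the filtrations correspond
  under `e_ℂ`), the filtrations of the two Kuga–Satake structures correspond under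
  `(ψ_Cl)_ℂ = (KugaSatake.evenEquivOfSimilar e)_ℂ`; whence the mutually inverse morphisms
  `kugaSatakeOfFormEquivHom` / `kugaSatakeOfFormEquivInv`: **a Hodge isometry (similarity) of
  admissible weight-two data induces an ISOMORPHISM of the Kuga–Satake Hodge structures.**

## References

* [Varesco2023] M. Varesco, *Hodge similarities, algebraic classes, and Kuga–Satake varieties*,
  arXiv:2304.02519, Lemmas 3.2–3.3 (materialised p. 12 in the tree's `KugaSatakeFunctoriality`).
* [Huybrechts2016K3] D. Huybrechts, *Lectures on K3 Surfaces*, Ch. 4 Rem. 2.3, §2.5, Prop. 3.1.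
-/

open scoped TensorProduct

noncomputable section

namespace Literature.AlgebraicGeometry.Motives

universe u

namespace HodgeStructure

open KugaSatake

variable {V : Type u} [AddCommGroup V] [Module ℚ V] {V' : Type u} [AddCommGroup V'] [Module ℚ V']
variable {H : HodgeStructure V 2} {H' : HodgeStructure V' 2}
variable (q : QuadraticForm ℚ V) (q' : QuadraticForm ℚ V')

/-! ### §1 `C^{1,0}` intrinsically, for an admissible form -/

/-- **`C⁺(q)^{1,0} = {x : (ω̄ω)·x = 0}`** inside `C⁺(q)_ℂ`, for an admissible form `q` and a
generator `ω` of `V^{2,0}` (from `ω² = ½q(ω, ω) = 0` and `ωω̄ + ω̄ω = q(ω, ω̄) ≠ 0`; the admissible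
version of the tree's `mem_kugaSatakeF1_iff_mulVecC_mul_eq_zero`). [cite: Varesco2023, Lemma 3.3] -/
theorem IsKugaSatakeAdmissible.mem_kugaSatakeFormF1_iff_mulVecC_mul_eq_zero
    (h : H.IsKugaSatakeAdmissible q) {ω : ℂ ⊗[ℚ] V} (hω : ω ∈ H.piece 2 0) (hω0 : ω ≠ 0)
    {x : ℂ ⊗[ℚ] CliffordAlgebra.even q} :
    x ∈ kugaSatakeFormF1 H q ↔ mulVecC q (conj ω) ω * x = 0 := by
  rw [mem_kugaSatakeFormF1_iff_of_ne_zero H q h.hodgeNumber_two_zero hω hω0]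
  set a := iotaC q ω with ha
  set b := iotaC q (conj ω) with hb
  set c : ℂ := LinearMap.BilinForm.baseChange ℂ (QuadraticMap.polarBilin q) ω (conj ω) with hc_def
  have hc : c ≠ 0 := h.polar_conj_ne_zero ω hω hω0
  have haa : a * a = 0 := by
    have h2 := iotaC_mul_iotaC_add_swap q ω ω
    rw [h.polar_self_eq_zero ω hω, map_zero, ← two_smul ℂ] at h2
    exact (smul_eq_zero.1 h2).resolve_left two_ne_zero
  have hab : a * b + b * a = algebraMap ℂ _ c := iotaC_mul_iotaC_add_swap q ω (conj ω)
  constructor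
  · intro hx
    apply evenInclC_injective q
    rw [map_mul, evenInclC_mulVecC, map_zero, mul_assoc, hx, mul_zero]
  · intro hx
    have h' := congrArg (evenInclC q) hx
    rw [map_mul, evenInclC_mulVecC, map_zero, mul_assoc] at h'
    have key : algebraMap ℂ _ c * (a * evenInclC q x) = 0 := by
      rw [← hab, add_mul, mul_assoc, h', mul_zero, zero_add, mul_assoc, ← mul_assoc a a, haa,
        zero_mul, mul_zero]
    rw [← Algebra.smul_def, smul_eq_zero] at key
    exact key.resolve_left hc

/-! ### §2 Similarities and the complexified polar forms -/

/-- A similarity of quadratic forms is a similarity of their polar forms: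
`polar q' (f v) (f w) = c · polar q v w`. [cite: Varesco2023, Lemma 3.2] -/
theorem polar_apply_apply_of_similar (f : V →ₗ[ℚ] V') (c : ℚ) (hf : ∀ v, q' (f v) = c * q v) (v w : V) :
    QuadraticMap.polar q' (f v) (f w) = c * QuadraticMap.polar q v w := by
  simp only [QuadraticMap.polar, ← map_add, hf]
  ring

/-- The complexified version: `q'_ℂ(f_ℂ x, f_ℂ y) = c · q_ℂ(x, y)` for the base-changed polar
forms. [cite: Varesco2023, Lemma 3.2] -/
theorem polarBilin_baseChange_apply_apply_of_similar (f : V →ₗ[ℚ] V') (c : ℚ) (hf : ∀ v, q' (f v) = c * q v)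
    (x y : ℂ ⊗[ℚ] V) :
    LinearMap.BilinForm.baseChange ℂ (QuadraticMap.polarBilin q') (f.baseChange ℂ x)
        (f.baseChange ℂ y) =
      (c : ℂ) * LinearMap.BilinForm.baseChange ℂ (QuadraticMap.polarBilin q) x y := by
  induction x using TensorProduct.induction_on with
  | zero => simp
  | add x₁ x₂ h₁ h₂ => simp only [map_add, LinearMap.add_apply, h₁, h₂, mul_add]
  | tmul a v =>
    induction y using TensorProduct.induction_on with
    | zero => simp
    | add y₁ y₂ h₁ h₂ => simp only [map_add, h₁, h₂, mul_add]
    | tmul d w =>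
      simp only [LinearMap.baseChange_tmul, LinearMap.BilinForm.baseChange_tmul,
        QuadraticMap.polarBilin_apply_apply, polar_apply_apply_of_similar q q' f c hf, Rat.smul_def, Rat.cast_mul]
      ring

/-- The base change of an injective `ℚ`-linear map is injective (`ℂ` is flat over `ℚ`).
Private plumbing. [folklore] -/
private theorem baseChange_injective {f : V →ₗ[ℚ] V'} (hf : Function.Injective f) :
    Function.Injective (f.baseChange ℂ) := by
  rw [LinearMap.baseChange_eq_ltensor]
  exact Module.Flat.lTensor_preserves_injective_linearMap f hf

/-- **Admissibility is transported along an injective Hodge similarity** onto a structure with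
`h'^{2,0} = 1`: `f_ℂ ω` generates `V'^{2,0}`, and `q'(f σ, f τ) = c q(σ, τ)`.
[cite: Varesco2023, Lemma 3.3] -/
theorem IsKugaSatakeAdmissible.of_similar (h : H.IsKugaSatakeAdmissible q)
    (h20' : H'.hodgeNumber 2 0 = 1) (f : Hom H H') (hfi : Function.Injective f.toLinearMap)
    {c : ℚ} (hc : c ≠ 0) (hf : ∀ v, q' (f.toLinearMap v) = c * q v) :
    H'.IsKugaSatakeAdmissible q' := by
  obtain ⟨ω, hω, hω0, -⟩ := exists_generator_piece_two_zero H h.hodgeNumber_two_zero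
  have hfω : f.toLinearMap.baseChange ℂ ω ∈ H'.piece 2 0 := f.map_piece_le 2 0 ⟨ω, hω, rfl⟩
  have hfω0 : f.toLinearMap.baseChange ℂ ω ≠ 0 := fun h0 =>
    hω0 (baseChange_injective hfi (by rw [h0, map_zero]))
  -- every `σ ∈ V'^{2,0}` is a multiple of `f_ℂ ω`
  have hspan : ∀ σ ∈ H'.piece 2 0, ∃ t : ℂ, σ = t • f.toLinearMap.baseChange ℂ ω := by
    intro σ hσ
    have hne : (⟨f.toLinearMap.baseChange ℂ ω, hfω⟩ : H'.piece 2 0) ≠ 0 := fun h0 =>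
      hfω0 (congrArg Subtype.val h0)
    obtain ⟨t, ht⟩ := (finrank_eq_one_iff_of_nonzero' _ hne).1 h20' ⟨σ, hσ⟩
    exact ⟨t, by simpa using congrArg Subtype.val ht.symm⟩
  have hcc : ((c : ℂ)) ≠ 0 := by exact_mod_cast hc
  refine ⟨h20', fun σ hσ ↦ ?_, fun σ hσ hσ0 ↦ ?_⟩
  · obtain ⟨t, rfl⟩ := hspan σ hσ
    simp only [map_smul, LinearMap.smul_apply, smul_eq_mul,
      polarBilin_baseChange_apply_apply_of_similar q q' f.toLinearMap c hf, h.polar_self_eq_zero ω hω, mul_zero]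
  · obtain ⟨t, rfl⟩ := hspan σ hσ
    have ht : t ≠ 0 := by
      rintro rfl
      exact hσ0 (zero_smul _ _)
    have hne := h.polar_conj_ne_zero ω hω hω0
    simp [map_smul, smul_eq_mul, conj_smul, conj_baseChange,
      polarBilin_baseChange_apply_apply_of_similar q q' f.toLinearMap c hf, ht, hcc, hne]

/-! ### §3 The morphism of Kuga–Satake structures induced by a Hodge similarity -/

/-- **Functoriality of `kugaSatakeOfForm` under Hodge similarities** (Varesco, Lemma 3.3, for
admissible forms): a morphism of weight-two Hodge structures `f : (V, H) → (V', H')`, injective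
and a similarity of unit multiplier `c` (`q'(f v) = c q(v)`; `c = 1`: a Hodge isometry), between
admissible data `(H, q)`, `(H', q')`, induces the morphism `ψ_Cl : Cl⁺(q) → Cl⁺(q')`
(`v w ↦ c⁻¹ (f v)(f w)`, the tree's `KugaSatake.evenMapOfSimilar`) of the weight-one Kuga–Satake
structures. [cite: Varesco2023, Lemma 3.3] -/
def kugaSatakeOfFormMap (h : H.IsKugaSatakeAdmissible q) (h' : H'.IsKugaSatakeAdmissible q')
    (f : Hom H H') (hfi : Function.Injective f.toLinearMap) (c : ℚˣ)
    (hf : ∀ v, q' (f.toLinearMap v) = (c : ℚ) * q v) :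
    Hom (kugaSatakeOfForm H q h) (kugaSatakeOfForm H' q' h') where
  toLinearMap := (evenMapOfSimilar q q' f.toLinearMap c hf).toLinearMap
  map_F_le p := by
    rintro _ ⟨x, hx, rfl⟩
    rw [SetLike.mem_coe, kugaSatakeOfForm_F] at hx
    rw [kugaSatakeOfForm_F]
    rcases le_or_gt p 0 with hp | hp
    · rw [kugaSatakeFormFiltration_of_nonpos H' q' hp]
      exact Submodule.mem_top
    rcases le_or_gt 2 p with hp2 | hp2
    · rw [kugaSatakeFormFiltration_of_two_le H q hp2, Submodule.mem_bot] at hx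
      rw [hx, map_zero]
      exact Submodule.zero_mem _
    obtain rfl : p = 1 := by omega
    rw [kugaSatakeFormFiltration_one] at hx ⊢
    obtain ⟨ω, hω, hω0, -⟩ := exists_generator_piece_two_zero H h.hodgeNumber_two_zero
    have hfω : f.toLinearMap.baseChange ℂ ω ∈ H'.piece 2 0 := f.map_piece_le 2 0 ⟨ω, hω, rfl⟩
    have hfω0 : f.toLinearMap.baseChange ℂ ω ≠ 0 := fun h0 =>
      hω0 (baseChange_injective hfi (by rw [h0, map_zero]))
    rw [h.mem_kugaSatakeFormF1_iff_mulVecC_mul_eq_zero q hω hω0] at hx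
    rw [h'.mem_kugaSatakeFormF1_iff_mulVecC_mul_eq_zero q' hfω hfω0, conj_baseChange]
    have hx' := congrArg ((evenMapOfSimilar q q' f.toLinearMap c hf).toLinearMap.baseChange ℂ) hx
    rw [map_zero, baseChange_map_mul, baseChange_evenMapOfSimilar_mulVecC, smul_mul_assoc,
      smul_eq_zero] at hx'
    exact hx'.resolve_left (Units.ne_zero _)

/-- The underlying linear map of `kugaSatakeOfFormMap` is `ψ_Cl`. [cite: Varesco2023, Lemma 3.3] -/
@[simp]
theorem kugaSatakeOfFormMap_toLinearMap (h : H.IsKugaSatakeAdmissible q)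
    (h' : H'.IsKugaSatakeAdmissible q') (f : Hom H H') (hfi : Function.Injective f.toLinearMap)
    (c : ℚˣ) (hf : ∀ v, q' (f.toLinearMap v) = (c : ℚ) * q v) :
    (kugaSatakeOfFormMap q q' h h' f hfi c hf).toLinearMap =
      (evenMapOfSimilar q q' f.toLinearMap c hf).toLinearMap :=
  rfl

/-! ### §4 Bijective Hodge similarities induce isomorphisms of Kuga–Satake structures -/

section Equiv

/-- The underlying linear map of `ψ_Cl` of a bijective similarity. Private plumbing. [folklore] -/
private theorem toLinearMap_evenEquivOfSimilar (e : V ≃ₗ[ℚ] V') (c : ℚˣ) (he : ∀ v, q' (e v) = (c : ℚ) * q v) :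
    (evenEquivOfSimilar q q' e c he).toLinearEquiv.toLinearMap =
      (evenMapOfSimilar q q' e.toLinearMap c he).toLinearMap :=
  rfl

/-- `(ψ_Cl⁻¹)_ℂ ∘ (ψ_Cl)_ℂ = id`. Private plumbing. [folklore] -/
private theorem symm_baseChange_baseChange_apply (e : V ≃ₗ[ℚ] V') (c : ℚˣ) (he : ∀ v, q' (e v) = (c : ℚ) * q v)
    (x : ℂ ⊗[ℚ] CliffordAlgebra.even q) :
    (evenMapOfSimilar q' q e.symm.toLinearMap c⁻¹ (similar_symm q q' e c he)).toLinearMap.baseChange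
        ℂ ((evenMapOfSimilar q q' e.toLinearMap c he).toLinearMap.baseChange ℂ x) = x := by
  rw [← LinearMap.comp_apply, ← LinearMap.baseChange_comp]
  have hcomp : (evenMapOfSimilar q' q e.symm.toLinearMap c⁻¹ (similar_symm q q' e c he)).toLinearMap
      ∘ₗ (evenMapOfSimilar q q' e.toLinearMap c he).toLinearMap = LinearMap.id :=
    LinearMap.ext fun z ↦ (evenEquivOfSimilar q q' e c he).symm_apply_apply z
  rw [hcomp, LinearMap.baseChange_id, LinearMap.id_apply]

/-- **The Kuga–Satake filtrations correspond under `(ψ_Cl)_ℂ`** for a bijective Hodge similarity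
`e : (V, H, q) ≅ (V', H', q')` (filtrations corresponding under `e_ℂ`) between admissible data:
`(ψ_Cl)_ℂ⁻¹ F^p Cl⁺(q') = F^p Cl⁺(q)` for every `p`. [cite: Varesco2023, Lemma 3.3] -/
theorem comap_kugaSatakeOfForm_F_eq (e : V ≃ₗ[ℚ] V') (c : ℚˣ) (he : ∀ v, q' (e v) = (c : ℚ) * q v)
    (hF : ∀ p, (H'.F p).comap (e.toLinearMap.baseChange ℂ) = H.F p) (h : H.IsKugaSatakeAdmissible q)
    (h' : H'.IsKugaSatakeAdmissible q') (p : ℤ) :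
    ((kugaSatakeOfForm H' q' h').F p).comap
        ((evenEquivOfSimilar q q' e c he).toLinearEquiv.toLinearMap.baseChange ℂ) =
      (kugaSatakeOfForm H q h).F p := by
  rw [toLinearMap_evenEquivOfSimilar q q' e c he]
  apply le_antisymm
  · intro x hx
    rw [Submodule.mem_comap] at hx
    have hback : (evenMapOfSimilar q' q e.symm.toLinearMap c⁻¹
        (similar_symm q q' e c he)).toLinearMap.baseChange ℂ
          ((evenMapOfSimilar q q' e.toLinearMap c he).toLinearMap.baseChange ℂ x) ∈
        (kugaSatakeOfForm H q h).F p :=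
      (kugaSatakeOfFormMap q' q h' h (Hom.symmOfComapBaseChange e hF) e.symm.injective c⁻¹
        (similar_symm q q' e c he)).map_F_le p ⟨_, hx, rfl⟩
    rwa [symm_baseChange_baseChange_apply q q' e c he] at hback
  · intro x hx
    rw [Submodule.mem_comap]
    exact (kugaSatakeOfFormMap q q' h h' (Hom.ofComapBaseChange e hF) e.injective c he).map_F_le p
      ⟨x, hx, rfl⟩

/-- **A bijective Hodge similarity of admissible data induces `ψ_Cl : KS(V, H, q) ≅ KS(V', H', q')`,
an isomorphism of weight-one Hodge structures** — the morphism. [cite: Varesco2023, Lemma 3.3] -/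
def kugaSatakeOfFormEquivHom (e : V ≃ₗ[ℚ] V') (c : ℚˣ) (he : ∀ v, q' (e v) = (c : ℚ) * q v)
    (hF : ∀ p, (H'.F p).comap (e.toLinearMap.baseChange ℂ) = H.F p) (h : H.IsKugaSatakeAdmissible q) (h' : H'.IsKugaSatakeAdmissible q') :
    Hom (kugaSatakeOfForm H q h) (kugaSatakeOfForm H' q' h') :=
  Hom.ofComapBaseChange (evenEquivOfSimilar q q' e c he).toLinearEquiv
    (comap_kugaSatakeOfForm_F_eq q q' e c he hF h h')

/-- Its underlying map is `ψ_Cl`. [cite: Varesco2023, Lemma 3.3] -/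
@[simp]
theorem kugaSatakeOfFormEquivHom_toLinearMap_apply (e : V ≃ₗ[ℚ] V') (c : ℚˣ) (he : ∀ v, q' (e v) = (c : ℚ) * q v)
    (hF : ∀ p, (H'.F p).comap (e.toLinearMap.baseChange ℂ) = H.F p) (h : H.IsKugaSatakeAdmissible q)
    (h' : H'.IsKugaSatakeAdmissible q') (z : CliffordAlgebra.even q) :
    (kugaSatakeOfFormEquivHom q q' e c he hF h h').toLinearMap z =
      evenEquivOfSimilar q q' e c he z :=
  rfl

/-- The inverse morphism `ψ_Cl⁻¹ : KS(V', H', q') → KS(V, H, q)`. [cite: Varesco2023, Lemma 3.3] -/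
def kugaSatakeOfFormEquivInv (e : V ≃ₗ[ℚ] V') (c : ℚˣ) (he : ∀ v, q' (e v) = (c : ℚ) * q v)
    (hF : ∀ p, (H'.F p).comap (e.toLinearMap.baseChange ℂ) = H.F p) (h : H.IsKugaSatakeAdmissible q) (h' : H'.IsKugaSatakeAdmissible q') :
    Hom (kugaSatakeOfForm H' q' h') (kugaSatakeOfForm H q h) :=
  Hom.symmOfComapBaseChange (evenEquivOfSimilar q q' e c he).toLinearEquiv
    (comap_kugaSatakeOfForm_F_eq q q' e c he hF h h')

/-- Its underlying map is `ψ_Cl⁻¹`. [cite: Varesco2023, Lemma 3.3] -/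
@[simp]
theorem kugaSatakeOfFormEquivInv_toLinearMap_apply (e : V ≃ₗ[ℚ] V') (c : ℚˣ) (he : ∀ v, q' (e v) = (c : ℚ) * q v)
    (hF : ∀ p, (H'.F p).comap (e.toLinearMap.baseChange ℂ) = H.F p) (h : H.IsKugaSatakeAdmissible q)
    (h' : H'.IsKugaSatakeAdmissible q') (z : CliffordAlgebra.even q') :
    (kugaSatakeOfFormEquivInv q q' e c he hF h h').toLinearMap z =
      (evenEquivOfSimilar q q' e c he).symm z :=
  rfl

/-- `ψ_Cl⁻¹ ∘ ψ_Cl = id`. [cite: Varesco2023, Lemma 3.3] -/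
theorem kugaSatakeOfFormEquivInv_hom_apply (e : V ≃ₗ[ℚ] V') (c : ℚˣ) (he : ∀ v, q' (e v) = (c : ℚ) * q v)
    (hF : ∀ p, (H'.F p).comap (e.toLinearMap.baseChange ℂ) = H.F p) (h : H.IsKugaSatakeAdmissible q)
    (h' : H'.IsKugaSatakeAdmissible q') (z : CliffordAlgebra.even q) :
    (kugaSatakeOfFormEquivInv q q' e c he hF h h').toLinearMap
        ((kugaSatakeOfFormEquivHom q q' e c he hF h h').toLinearMap z) = z :=
  (evenEquivOfSimilar q q' e c he).symm_apply_apply z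

/-- `ψ_Cl ∘ ψ_Cl⁻¹ = id`. [cite: Varesco2023, Lemma 3.3] -/
theorem kugaSatakeOfFormEquivHom_inv_apply (e : V ≃ₗ[ℚ] V') (c : ℚˣ) (he : ∀ v, q' (e v) = (c : ℚ) * q v)
    (hF : ∀ p, (H'.F p).comap (e.toLinearMap.baseChange ℂ) = H.F p) (h : H.IsKugaSatakeAdmissible q)
    (h' : H'.IsKugaSatakeAdmissible q') (z : CliffordAlgebra.even q') :
    (kugaSatakeOfFormEquivHom q q' e c he hF h h').toLinearMap
        ((kugaSatakeOfFormEquivInv q q' e c he hF h h').toLinearMap z) = z :=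
  (evenEquivOfSimilar q q' e c he).apply_symm_apply z

end Equiv

end HodgeStructure

end Literature.AlgebraicGeometry.Motives

end
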